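import Mathlib.Algebra.Lie.Engel
import Summits.ValiantsHypothesis.ValiantsHypothesis.Theorems.FreeSubtorusOrbitDimensionBoundStubStableReductionBiorthogonal

/-!
# `OrbitDimensionBound` (stmt-ValiantsHypothesis-16133), rung line `square_covering` — stub `stub_stableReduction`,
# infrastructure: the radical of a local endomorphism algebra and its common kernel (Engel) (plan step I5a, part 1)

Sixth helper file toward stub 1 `stub_stableReduction` (plan HOME/lmr/NOTE-p4g12-16133-stableReduction-plan.md).
For a pencil `N` (square matrix of polynomials, size `k₀ ≥ 1`) whose endomorphism algebra
`End N = {(x_W, x_V) constant : x_W N = N x_V}` is LOCAL (every pair is `μ + nilpotent`), the RADICAL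
`J = {(x_W, x_V) ∈ End N : x_W nilpotent}`:

* `hom_add`, `hom_smul_one` — (with `hom_comp`, `hom_sub` of `…StubPerSummandPrelimB`) `End N` is an algebra;
* `nilpair_V`, `nilpair_add`, `nilpair_smul`, `nilpair_mul_left`, `nilpair_mul_right` — `J` is a two-sided ideal all of
  whose members have BOTH components nilpotent (trace lemma `isNilpotent_of_local_of_trace`; units via determinants);
* **`exists_common_kernel`** — ENGEL: the `V`-components `{x_V : x ∈ J}` form a Lie subalgebra of `gl(V)` of nilpotent
  operators, so (Mathlib's Engel theorem `LieModule.isNilpotent_iff_forall'` and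
  `LieModule.nontrivial_max_triv_of_isNilpotent`) they have a common non-zero kernel vector.

Helper mode (`--supports stmt-ValiantsHypothesis-16133 --as helper`).  Honest framing: infrastructure toward ONE
registered stub of a dormant rung line whose core `stub_gradedPowerCount` is OPEN; `OrbitDimensionBound`,
`FreeSubtorus` and VP ≠ VNP are OPEN and not moved.

## References
* N. Jacobson, *Lie Algebras* (1962), Ch. II §2 (Engel's theorem) — orientation only; the tree uses Mathlib's form.
-/

set_option linter.dupNamespace false

namespace Summit.ValiantsHypothesis.ValiantsHypothesis.Theorems.FreeSubtorusOrbitDimensionBound.SquareCovering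

open Matrix MvPolynomial Finset Module.End
open Literature.Computability.AlgebraicComplexity
open Summit.ValiantsHypothesis.ValiantsHypothesis.Theorems.FreeSubtorusOrbitDimensionBound.SignCovering.PerSummand

section Radical

variable {σ : Type*} {k₀ : ℕ}

/-- `End N` is closed under sums. [folklore] -/
theorem hom_add {ι κ : Type*} [Fintype ι] [Fintype κ] {N₁ : Matrix ι ι (MvPolynomial σ ℂ)}
    {N₂ : Matrix κ κ (MvPolynomial σ ℂ)} {XW XV YW YV : Matrix κ ι ℂ}
    (hX : XW.map (C (σ := σ)) * N₁ = N₂ * XV.map (C (σ := σ)))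
    (hY : YW.map (C (σ := σ)) * N₁ = N₂ * YV.map (C (σ := σ))) :
    (XW + YW).map (C (σ := σ)) * N₁ = N₂ * (XV + YV).map (C (σ := σ)) := by
  rw [Matrix.map_add C (map_add C), Matrix.map_add C (map_add C), Matrix.add_mul, Matrix.mul_add, hX, hY]

/-- Scalar pairs `(c, c)` are endomorphisms of every pencil. [folklore] -/
theorem hom_smul_one (c : ℂ) (N : Matrix (Fin k₀) (Fin k₀) (MvPolynomial σ ℂ)) :
    (c • (1 : Matrix (Fin k₀) (Fin k₀) ℂ)).map (C (σ := σ)) * N =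
      N * (c • (1 : Matrix (Fin k₀) (Fin k₀) ℂ)).map (C (σ := σ)) := by
  rw [Matrix.smul_one_eq_diagonal, Matrix.diagonal_map (map_zero C)]
  ext i j
  rw [Matrix.diagonal_mul, Matrix.mul_diagonal, mul_comm]

/-- A nilpotent square matrix of size `≥ 1` is not a unit. [folklore] -/
theorem not_isUnit_of_isNilpotent' (hk₀ : 0 < k₀) {x : Matrix (Fin k₀) (Fin k₀) ℂ} (hx : IsNilpotent x) :
    ¬ IsUnit x := by
  intro hu
  obtain ⟨n, hn⟩ := hx
  have h1 : x.det ^ n = 0 := by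
    haveI : Nonempty (Fin k₀) := ⟨⟨0, hk₀⟩⟩
    rw [← Matrix.det_pow, hn, Matrix.det_zero]
  exact ((Matrix.isUnit_iff_isUnit_det x).1 hu).ne_zero (pow_eq_zero_iff'.1 h1).1

/-- In the radical both components are nilpotent. [folklore] -/
theorem nilpair_V (N : Matrix (Fin k₀) (Fin k₀) (MvPolynomial σ ℂ)) (hk₀ : 0 < k₀)
    (hloc : ∀ g h : Matrix (Fin k₀) (Fin k₀) ℂ, g.map C * N = N * h.map C →
      ∃ μ : ℂ, IsNilpotent (g - μ • (1 : Matrix (Fin k₀) (Fin k₀) ℂ)) ∧ IsNilpotent (h - μ • (1 : Matrix (Fin k₀) (Fin k₀) ℂ)))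
    {xW xV : Matrix (Fin k₀) (Fin k₀) ℂ} (hx : xW.map (C (σ := σ)) * N = N * xV.map (C (σ := σ)))
    (hn : IsNilpotent xW) : IsNilpotent xV :=
  (isNilpotent_of_local_of_trace N hk₀ hloc xW xV hx (Matrix.isNilpotent_trace_of_isNilpotent hn).eq_zero).2

/-- The radical is closed under sums (trace). [folklore] -/
theorem nilpair_add (N : Matrix (Fin k₀) (Fin k₀) (MvPolynomial σ ℂ)) (hk₀ : 0 < k₀)
    (hloc : ∀ g h : Matrix (Fin k₀) (Fin k₀) ℂ, g.map C * N = N * h.map C →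
      ∃ μ : ℂ, IsNilpotent (g - μ • (1 : Matrix (Fin k₀) (Fin k₀) ℂ)) ∧ IsNilpotent (h - μ • (1 : Matrix (Fin k₀) (Fin k₀) ℂ)))
    {xW xV yW yV : Matrix (Fin k₀) (Fin k₀) ℂ} (hx : xW.map (C (σ := σ)) * N = N * xV.map (C (σ := σ)))
    (hy : yW.map (C (σ := σ)) * N = N * yV.map (C (σ := σ))) (hxn : IsNilpotent xW) (hyn : IsNilpotent yW) :
    IsNilpotent (xW + yW) :=
  (isNilpotent_of_local_of_trace N hk₀ hloc _ _ (hom_add hx hy) (by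
    rw [Matrix.trace_add, (Matrix.isNilpotent_trace_of_isNilpotent hxn).eq_zero,
      (Matrix.isNilpotent_trace_of_isNilpotent hyn).eq_zero, add_zero])).1

/-- The radical is a right ideal: `x ∈ J`, `y ∈ End N` ⇒ `x y ∈ J` (here written `y` applied first). [folklore] -/
theorem nilpair_mul_right (N : Matrix (Fin k₀) (Fin k₀) (MvPolynomial σ ℂ)) (hk₀ : 0 < k₀)
    (hloc : ∀ g h : Matrix (Fin k₀) (Fin k₀) ℂ, g.map C * N = N * h.map C →
      ∃ μ : ℂ, IsNilpotent (g - μ • (1 : Matrix (Fin k₀) (Fin k₀) ℂ)) ∧ IsNilpotent (h - μ • (1 : Matrix (Fin k₀) (Fin k₀) ℂ)))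
    {xW xV yW yV : Matrix (Fin k₀) (Fin k₀) ℂ} (hx : xW.map (C (σ := σ)) * N = N * xV.map (C (σ := σ)))
    (hy : yW.map (C (σ := σ)) * N = N * yV.map (C (σ := σ))) (hxn : IsNilpotent xW) :
    IsNilpotent (xW * yW) := by
  obtain ⟨μ, hW, -⟩ := hloc _ _ (hom_comp hy hx)
  by_cases hμ : μ = 0
  · subst hμ; rwa [zero_smul, sub_zero] at hW
  · exfalso
    have hu : IsUnit (xW * yW) := isUnit_of_isNilpotent_sub_smul_one hμ hW
    rw [Matrix.isUnit_iff_isUnit_det, Matrix.det_mul, IsUnit.mul_iff] at hu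
    exact not_isUnit_of_isNilpotent' hk₀ hxn ((Matrix.isUnit_iff_isUnit_det xW).2 hu.1)

/-- The radical is a left ideal: `x ∈ J`, `y ∈ End N` ⇒ `y x ∈ J`. [folklore] -/
theorem nilpair_mul_left (N : Matrix (Fin k₀) (Fin k₀) (MvPolynomial σ ℂ)) (hk₀ : 0 < k₀)
    (hloc : ∀ g h : Matrix (Fin k₀) (Fin k₀) ℂ, g.map C * N = N * h.map C →
      ∃ μ : ℂ, IsNilpotent (g - μ • (1 : Matrix (Fin k₀) (Fin k₀) ℂ)) ∧ IsNilpotent (h - μ • (1 : Matrix (Fin k₀) (Fin k₀) ℂ)))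
    {xW xV yW yV : Matrix (Fin k₀) (Fin k₀) ℂ} (hx : xW.map (C (σ := σ)) * N = N * xV.map (C (σ := σ)))
    (hy : yW.map (C (σ := σ)) * N = N * yV.map (C (σ := σ))) (hxn : IsNilpotent xW) :
    IsNilpotent (yW * xW) := by
  obtain ⟨μ, hW, -⟩ := hloc _ _ (hom_comp hx hy)
  by_cases hμ : μ = 0
  · subst hμ; rwa [zero_smul, sub_zero] at hW
  · exfalso
    have hu : IsUnit (yW * xW) := isUnit_of_isNilpotent_sub_smul_one hμ hW
    rw [Matrix.isUnit_iff_isUnit_det, Matrix.det_mul, IsUnit.mul_iff] at hu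
    exact not_isUnit_of_isNilpotent' hk₀ hxn ((Matrix.isUnit_iff_isUnit_det xW).2 hu.2)

/-- The radical is closed under scalars. [folklore] -/
theorem nilpair_smul (N : Matrix (Fin k₀) (Fin k₀) (MvPolynomial σ ℂ)) (hk₀ : 0 < k₀)
    (hloc : ∀ g h : Matrix (Fin k₀) (Fin k₀) ℂ, g.map C * N = N * h.map C →
      ∃ μ : ℂ, IsNilpotent (g - μ • (1 : Matrix (Fin k₀) (Fin k₀) ℂ)) ∧ IsNilpotent (h - μ • (1 : Matrix (Fin k₀) (Fin k₀) ℂ)))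
    {xW xV : Matrix (Fin k₀) (Fin k₀) ℂ} (hx : xW.map (C (σ := σ)) * N = N * xV.map (C (σ := σ)))
    (hxn : IsNilpotent xW) (c : ℂ) : IsNilpotent (c • xW) := by
  rw [← smul_one_mul c xW]
  exact nilpair_mul_left N hk₀ hloc hx (hom_smul_one c N) hxn

end Radical

/-! ### Engel: the radical has a common kernel vector -/

section Engel

variable {σ : Type*} {k₀ : ℕ}

/-- **Common kernel of the radical** (Engel's theorem): if `End N` is local and `k₀ ≥ 1`, some `v ≠ 0` is killed by
`x_V` for every `(x_W, x_V) ∈ End N` with `x_W` nilpotent. [folklore] -/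
theorem exists_common_kernel (N : Matrix (Fin k₀) (Fin k₀) (MvPolynomial σ ℂ)) (hk₀ : 0 < k₀)
    (hloc : ∀ g h : Matrix (Fin k₀) (Fin k₀) ℂ, g.map C * N = N * h.map C →
      ∃ μ : ℂ, IsNilpotent (g - μ • (1 : Matrix (Fin k₀) (Fin k₀) ℂ)) ∧ IsNilpotent (h - μ • (1 : Matrix (Fin k₀) (Fin k₀) ℂ))) :
    ∃ v : Fin k₀ → ℂ, v ≠ 0 ∧ ∀ xW xV : Matrix (Fin k₀) (Fin k₀) ℂ,
      xW.map (C (σ := σ)) * N = N * xV.map (C (σ := σ)) → IsNilpotent xW → Matrix.toLin' xV v = 0 := by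
  classical
  -- `gl(V)` as a Lie algebra via the commutator (a `def` in this Mathlib, enabled locally inside the proof)
  letI : LieRing (Module.End ℂ (Fin k₀ → ℂ)) := LieRing.ofAssociativeRing
  -- the Lie subalgebra of `gl(V)` of `V`-components of the radical
  let S : LieSubalgebra ℂ (Module.End ℂ (Fin k₀ → ℂ)) :=
    { carrier := {f | ∃ xW xV : Matrix (Fin k₀) (Fin k₀) ℂ,
        xW.map (C (σ := σ)) * N = N * xV.map (C (σ := σ)) ∧ IsNilpotent xW ∧ f = Matrix.toLin' xV}
      add_mem' := by
        rintro f g ⟨xW, xV, hx, hxn, rfl⟩ ⟨yW, yV, hy, hyn, rfl⟩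
        exact ⟨xW + yW, xV + yV, hom_add hx hy, nilpair_add N hk₀ hloc hx hy hxn hyn, by rw [map_add]⟩
      zero_mem' := ⟨0, 0, by simp, IsNilpotent.zero, by rw [map_zero]⟩
      smul_mem' := by
        rintro c f ⟨xW, xV, hx, hxn, rfl⟩
        refine ⟨c • xW, c • xV, ?_, nilpair_smul N hk₀ hloc hx hxn c, by rw [map_smul]⟩
        rw [← smul_one_mul c xW, ← smul_one_mul c xV]
        exact hom_comp hx (hom_smul_one c N)
      lie_mem' := by
        rintro f g ⟨xW, xV, hx, hxn, rfl⟩ ⟨yW, yV, hy, hyn, rfl⟩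
        refine ⟨xW * yW - yW * xW, xV * yV - yV * xV, hom_sub (hom_comp hy hx) (hom_comp hx hy), ?_, ?_⟩
        · exact (isNilpotent_of_local_of_trace N hk₀ hloc _ _ (hom_sub (hom_comp hy hx) (hom_comp hx hy))
            (by rw [Matrix.trace_sub, Matrix.trace_mul_comm, sub_self])).1
        · rw [Ring.lie_def, map_sub, Matrix.toLin'_mul, Matrix.toLin'_mul]; rfl }
  -- every element of `S` acts nilpotently on `V`
  have hnil : ∀ x : S, IsNilpotent (LieModule.toEnd ℂ S (Fin k₀ → ℂ) x) := by
    rintro ⟨f, xW, xV, hx, hxn, rfl⟩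
    have hV : IsNilpotent xV := nilpair_V N hk₀ hloc hx hxn
    have h1 : LieModule.toEnd ℂ S (Fin k₀ → ℂ) ⟨Matrix.toLin' xV, xW, xV, hx, hxn, rfl⟩ = Matrix.toLin' xV := by
      ext v
      simp
    rw [h1]
    obtain ⟨n, hn⟩ := hV
    exact ⟨n, by rw [show Matrix.toLin' xV = Matrix.toLinAlgEquiv' xV from rfl, ← map_pow, hn, map_zero]⟩
  haveI : LieModule.IsNilpotent S (Fin k₀ → ℂ) := (LieModule.isNilpotent_iff_forall' (R := ℂ)).2 hnil
  haveI : Nonempty (Fin k₀) := ⟨⟨0, hk₀⟩⟩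
  haveI : Nontrivial (LieModule.maxTrivSubmodule ℂ S (Fin k₀ → ℂ)) :=
    LieModule.nontrivial_max_triv_of_isNilpotent ℂ S (Fin k₀ → ℂ)
  obtain ⟨⟨v, hv⟩, hv0⟩ := exists_ne (0 : LieModule.maxTrivSubmodule ℂ S (Fin k₀ → ℂ))
  refine ⟨v, fun h => hv0 (Subtype.ext h), fun xW xV hx hxn => ?_⟩
  rw [LieModule.mem_maxTrivSubmodule] at hv
  have h1 := hv ⟨Matrix.toLin' xV, xW, xV, hx, hxn, rfl⟩
  simpa [LieSubalgebra.coe_bracket_of_module] using h1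

end Engel

end Summit.ValiantsHypothesis.ValiantsHypothesis.Theorems.FreeSubtorusOrbitDimensionBound.SquareCovering
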